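import Summits.BirchSwinnertonDyer.BirchSwinnertonDyer.Theorems.ClassRecordThreeEulerHalvesAtThreeCartanSupplyCubicFibres
import Summits.BirchSwinnertonDyer.BirchSwinnertonDyer.Theorems.ClassRecordThreeEulerHalvesAtThreeCartanSupplyFixedPointsP1
import HarnessLib

/-!
# The lattice `V₁ = ker(ℤ[X] → ℤ[ℙ¹])` and its character `2·χ_W` — over `ℤ`, by finite-index comparison

Helper file `--supports stmt-BirchSwinnertonDyer-23422` (seat `bsd-stepL-tam3-p1` g23, LINE OWNER of crux 23422, line `cartan` v11), serving the registered
stub (SUPPLY) `stub_cartanTorusLatticeSupply` (memo `HOME/tam3-p1/g23/SUPPLY-ROAD-GG1.md` §2), continuing `…CubicClasses ∕ Hecke ∕ HeckeSquare ∕ Fibres`.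
INTEGRAL throughout (no `⊗ℚ`): the FIBRE SUM `fibreSum : ℤ[X] → ℤ[ℙ¹]` and the PULL-BACK `pull : ℤ[ℙ¹] → ℤ[X]` are equivariant with
`fibreSum ∘ pull = 3` (`q ≡ 1 (3)`: three classes over each point), so `Φ′ = ι_{V₁} ⊕ pull : V₁ × ℤ[ℙ¹] → ℤ[X]` and
`Ψ′ = (3 − pull∘fibreSum, fibreSum)` satisfy `Φ′Ψ′ = 3`, `Ψ′Φ′ = 3`; the generic FINITE-INDEX TRACE COMPARISON `trace_eq_of_intertwine`
(`ΦΨ = k = ΨΦ`, `k ≠ 0`, `fΦ = Φg ⇒ tr f = tr g`, from `LinearMap.trace_comp_comm'`) and `trace_prodMap'` give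
`tr(g | ℤ[X]) = tr(g | V₁) + tr(g | ℤ[ℙ¹])`; the two permutation traces are the fixed-point counts `F(g)` (`…CubicClasses.card_fixed_mul_card_cubes`,
`…CubicPointsFixedCount`) and `F_{ℙ¹}(g)` (`…FixedPointsP1.natCard_fixed_P1`), whence **`trace_act_V1`** :
`tr(g | V₁) = 2·χ_W(g)` with `χ_W = cubicNewvectorChar q` BY NAME (`…CubicPointsFixedCount.fixedType_sub_fixedP1Type`).
HONEST FRAMING: finite-group bookkeeping; nothing about SUPPLY, NUM, crux 23422 ∕ 19109 is proved here; BSD is proved for no curve. [folklore]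
-/

namespace Summit.BirchSwinnertonDyer.BirchSwinnertonDyer.Theorems.CartanSupply.CubicV1

open Summit.BirchSwinnertonDyer.BirchSwinnertonDyer.Theorems.CartanDegree
open Summit.BirchSwinnertonDyer.BirchSwinnertonDyer.Theorems.CartanTorusCubeCut
open Summit.BirchSwinnertonDyer.BirchSwinnertonDyer.Theorems.CartanSupply.CubicClasses
open Summit.BirchSwinnertonDyer.BirchSwinnertonDyer.Theorems.CartanSupply.CubicHecke
open Summit.BirchSwinnertonDyer.BirchSwinnertonDyer.Theorems.CartanSupply.CubicFibres

set_option linter.dupNamespace false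
set_option autoImplicit false

open scoped Classical

/-! ## §1 Generic: permutation traces over `ℤ` and the finite-index trace comparison -/

section generic

/-- PROVED: over `ℤ`, the trace of `φ ↦ φ ∘ τ` is the number of fixed points of `τ`. [folklore] -/
theorem trace_funLeft_perm_int {ι : Type*} [Fintype ι] [DecidableEq ι] (τ : Equiv.Perm ι) :
    LinearMap.trace ℤ (ι → ℤ) (LinearMap.funLeft ℤ ℤ τ) = ((Finset.univ.filter fun i => τ i = i).card : ℤ) := by
  rw [LinearMap.trace_eq_matrix_trace ℤ (Pi.basisFun ℤ ι)]
  have h : ∀ i : ι, LinearMap.toMatrix (Pi.basisFun ℤ ι) (Pi.basisFun ℤ ι) (LinearMap.funLeft ℤ ℤ τ) i i = if τ i = i then 1 else 0 := by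
    intro i
    rw [LinearMap.toMatrix_apply, Pi.basisFun_repr, Pi.basisFun_apply, LinearMap.funLeft_apply]
    by_cases hi : τ i = i
    · rw [if_pos hi, hi, Pi.single_eq_same]
    · rw [if_neg hi, Pi.single_eq_of_ne hi]
  simp only [Matrix.trace, Matrix.diag_apply, h, Finset.sum_boole]

/-- PROVED: the fixed points of `τ⁻¹` are those of `τ`. [folklore] -/
theorem card_fixed_inv {ι : Type*} [Fintype ι] (τ : Equiv.Perm ι) :
    (Finset.univ.filter fun i => τ⁻¹ i = i).card = (Finset.univ.filter fun i => τ i = i).card := by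
  congr 1
  ext i
  simp only [Finset.mem_filter, Finset.mem_univ, true_and]
  rw [Equiv.Perm.inv_eq_iff_eq, eq_comm]

variable {M N : Type*} [AddCommGroup M] [Module.Free ℤ M] [Module.Finite ℤ M]
  [AddCommGroup N] [Module.Free ℤ N] [Module.Finite ℤ N]

/-- PROVED — **FINITE-INDEX TRACE COMPARISON**: if `Φ : N → M`, `Ψ : M → N` satisfy `ΦΨ = k·id`, `ΨΦ = k·id` with `k ≠ 0` and `f Φ = Φ g`,
then `tr f = tr g`. [folklore] -/
theorem trace_eq_of_intertwine (Φ : N →ₗ[ℤ] M) (Ψ : M →ₗ[ℤ] N) (k : ℤ) (hk : k ≠ 0)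
    (h1 : Φ ∘ₗ Ψ = k • LinearMap.id) (h2 : Ψ ∘ₗ Φ = k • LinearMap.id)
    (f : M →ₗ[ℤ] M) (g : N →ₗ[ℤ] N) (hc : f ∘ₗ Φ = Φ ∘ₗ g) :
    LinearMap.trace ℤ M f = LinearMap.trace ℤ N g := by
  apply mul_left_cancel₀ hk
  have hM : k * LinearMap.trace ℤ M f = LinearMap.trace ℤ M (f ∘ₗ Φ ∘ₗ Ψ) := by
    rw [h1, LinearMap.comp_smul, LinearMap.comp_id, map_smul, smul_eq_mul]
  have hN : k * LinearMap.trace ℤ N g = LinearMap.trace ℤ N (Ψ ∘ₗ Φ ∘ₗ g) := by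
    rw [← LinearMap.comp_assoc, h2, LinearMap.smul_comp, LinearMap.id_comp, map_smul, smul_eq_mul]
  rw [hM, hN, ← LinearMap.comp_assoc, LinearMap.trace_comp_comm', hc]

end generic

variable {q : ℕ} [Fact q.Prime]

/-! ## §2 `ℤ[ℙ¹]`, the fibre sum and the pull-back -/

/-- `ℙ¹(𝔽_q)` is a finite type (via `Option 𝔽_q ≃ ℙ¹`). -/
noncomputable instance fintypeP1 : Fintype (Steinberg.P1 q) := Fintype.ofEquiv _ Steinberg.optEquiv

/-- The action of `g` on `ℤ[ℙ¹]`: `(actP g ψ)(p) = ψ(g⁻¹ p)`. -/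
noncomputable def actP (g : G q) : (Steinberg.P1 q → ℤ) →ₗ[ℤ] (Steinberg.P1 q → ℤ) :=
  LinearMap.funLeft ℤ ℤ (MulAction.toPerm (g⁻¹ : G q))

/-- PROVED: unfolding. [folklore] -/
theorem actP_apply (g : G q) (ψ : Steinberg.P1 q → ℤ) (p : Steinberg.P1 q) : actP g ψ p = ψ (g⁻¹ • p) := rfl

/-- The FIBRE SUM `ℤ[X] → ℤ[ℙ¹]`. -/
noncomputable def fibreSum : (X q → ℤ) →ₗ[ℤ] (Steinberg.P1 q → ℤ) where
  toFun φ p := ∑ x ∈ Finset.univ.filter (fun x : X q => toP1 x = p), φ x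
  map_add' φ ψ := by funext p; simp only [Pi.add_apply, Finset.sum_add_distrib]
  map_smul' c φ := by funext p; simp only [Pi.smul_apply, smul_eq_mul, RingHom.id_apply, Finset.mul_sum]

/-- PROVED: unfolding. [folklore] -/
theorem fibreSum_apply (φ : X q → ℤ) (p : Steinberg.P1 q) :
    fibreSum φ p = ∑ x ∈ Finset.univ.filter (fun x : X q => toP1 x = p), φ x := rfl

/-- The PULL-BACK `ℤ[ℙ¹] → ℤ[X]`, `(pull ψ)(x) = ψ(toP1 x)`. -/
noncomputable def pull : (Steinberg.P1 q → ℤ) →ₗ[ℤ] (X q → ℤ) := LinearMap.funLeft ℤ ℤ (toP1 : X q → Steinberg.P1 q)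

/-- PROVED: unfolding. [folklore] -/
theorem pull_apply (ψ : Steinberg.P1 q → ℤ) (x : X q) : pull ψ x = ψ (toP1 x) := rfl

/-- PROVED (`q ≡ 1 (3)`): each fibre of `toP1` has three points. [folklore] -/
theorem card_fibre (h1 : q % 3 = 1) (p : Steinberg.P1 q) : (Finset.univ.filter fun x : X q => toP1 x = p).card = 3 := by
  obtain ⟨ζ, hζ⟩ := exists_nonCube h1
  obtain ⟨x₀, rfl⟩ := toP1_surjective p
  obtain ⟨hd1, hd2, hd3⟩ := three_distinct hζ x₀
  rw [fibre_eq h1 hζ, Finset.card_insert_of_notMem, Finset.card_pair hd3.symm]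
  simp only [Finset.mem_insert, Finset.mem_singleton, not_or]
  exact ⟨hd1.symm, hd2.symm⟩

/-- PROVED — **`fibreSum ∘ pull = 3`** (`q ≡ 1 (3)`). [folklore] -/
theorem fibreSum_comp_pull (h1 : q % 3 = 1) :
    fibreSum ∘ₗ pull = (3 : ℤ) • (LinearMap.id : (Steinberg.P1 q → ℤ) →ₗ[ℤ] (Steinberg.P1 q → ℤ)) := by
  refine LinearMap.ext fun ψ => funext fun p => ?_
  rw [LinearMap.comp_apply, fibreSum_apply, LinearMap.smul_apply, LinearMap.id_apply, Pi.smul_apply, smul_eq_mul]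
  have : ∀ x ∈ Finset.univ.filter (fun x : X q => toP1 x = p), pull ψ x = ψ p := by
    intro x hx
    simp only [Finset.mem_filter, Finset.mem_univ, true_and] at hx
    rw [pull_apply, hx]
  rw [Finset.sum_congr rfl this, Finset.sum_const, card_fibre h1, nsmul_eq_mul, Nat.cast_ofNat]

/-- PROVED — **EQUIVARIANCE OF THE FIBRE SUM**. [folklore] -/
theorem fibreSum_comp_act (g : G q) : fibreSum ∘ₗ act ℤ g = actP g ∘ₗ (fibreSum : (X q → ℤ) →ₗ[ℤ] (Steinberg.P1 q → ℤ)) := by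
  refine LinearMap.ext fun φ => funext fun p => ?_
  rw [LinearMap.comp_apply, LinearMap.comp_apply, fibreSum_apply, actP_apply, fibreSum_apply, Finset.sum_filter, Finset.sum_filter]
  simp only [act_apply]
  rw [← Equiv.sum_comp (σX g) (fun x => if toP1 x = p then φ (σX g⁻¹ x) else 0)]
  refine Finset.sum_congr rfl fun z _ => ?_
  have hz : σX g⁻¹ (σX g z) = z := by rw [← Equiv.Perm.mul_apply, ← map_mul, inv_mul_cancel, map_one, Equiv.Perm.one_apply]
  have hp : toP1 (σX g z) = p ↔ toP1 z = g⁻¹ • p := by rw [toP1_σX, eq_inv_smul_iff]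
  simp only [hz, hp]

/-- PROVED — **EQUIVARIANCE OF THE PULL-BACK**. [folklore] -/
theorem pull_comp_actP (g : G q) : pull ∘ₗ actP g = act ℤ g ∘ₗ (pull : (Steinberg.P1 q → ℤ) →ₗ[ℤ] (X q → ℤ)) := by
  refine LinearMap.ext fun ψ => funext fun x => ?_
  rw [LinearMap.comp_apply, LinearMap.comp_apply, pull_apply, actP_apply, act_apply, pull_apply, toP1_σX]

/-! ## §3 `V₁ = ker fibreSum`; the comparison maps `Φ′`, `Ψ′` -/

/-- The lattice `V₁ = ker(fibreSum) ⊂ ℤ[X]`. -/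
noncomputable def V1 (q : ℕ) [Fact q.Prime] : Submodule ℤ (X q → ℤ) := LinearMap.ker (fibreSum : (X q → ℤ) →ₗ[ℤ] _)

/-- PROVED: membership. [folklore] -/
theorem mem_V1_iff (φ : X q → ℤ) : φ ∈ V1 q ↔ ∀ p : Steinberg.P1 q, ∑ x ∈ Finset.univ.filter (fun x : X q => toP1 x = p), φ x = 0 := by
  rw [V1, LinearMap.mem_ker]
  exact ⟨fun h p => by rw [← fibreSum_apply, h]; rfl, fun h => funext fun p => h p⟩

/-- PROVED: `V₁` is `G`-stable. [folklore] -/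
theorem act_mem_V1 (g : G q) : ∀ φ ∈ V1 q, act ℤ g φ ∈ V1 q := by
  intro φ hφ
  rw [V1, LinearMap.mem_ker] at hφ ⊢
  rw [← LinearMap.comp_apply, fibreSum_comp_act, LinearMap.comp_apply, hφ, map_zero]

/-- The action on `V₁`. -/
noncomputable def actV1 (g : G q) : V1 q →ₗ[ℤ] V1 q := (act ℤ g).restrict (act_mem_V1 g)

/-- `Φ′ : V₁ × ℤ[ℙ¹] → ℤ[X]`, `(v, ψ) ↦ v + pull ψ`. -/
noncomputable def PhiV : (V1 q × (Steinberg.P1 q → ℤ)) →ₗ[ℤ] (X q → ℤ) := (V1 q).subtype.coprod pull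

/-- PROVED: unfolding. [folklore] -/
theorem PhiV_apply (v : V1 q) (ψ : Steinberg.P1 q → ℤ) : PhiV (v, ψ) = (v : X q → ℤ) + pull ψ := rfl

/-- The map `3 − pull ∘ fibreSum` on `ℤ[X]`. -/
noncomputable def threeSubPull : (X q → ℤ) →ₗ[ℤ] (X q → ℤ) := (3 : ℤ) • LinearMap.id - pull ∘ₗ fibreSum

/-- PROVED: unfolding. [folklore] -/
theorem threeSubPull_apply (φ : X q → ℤ) : threeSubPull φ = (3 : ℤ) • φ - pull (fibreSum φ) := rfl

/-- PROVED: `3φ − pull(fibreSum φ) ∈ V₁` (`q ≡ 1 (3)`). [folklore] -/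
theorem threeSubPull_mem (h1 : q % 3 = 1) (φ : X q → ℤ) : threeSubPull φ ∈ V1 q := by
  rw [V1, LinearMap.mem_ker, threeSubPull_apply, map_sub, map_smul, ← LinearMap.comp_apply, fibreSum_comp_pull h1,
    LinearMap.smul_apply, LinearMap.id_apply, sub_self]

/-- `Ψ′ : ℤ[X] → V₁ × ℤ[ℙ¹]`, `φ ↦ (3φ − pull(fibreSum φ), fibreSum φ)`. -/
noncomputable def PsiV (h1 : q % 3 = 1) : (X q → ℤ) →ₗ[ℤ] (V1 q × (Steinberg.P1 q → ℤ)) :=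
  LinearMap.prod (LinearMap.codRestrict (V1 q) threeSubPull (threeSubPull_mem h1)) fibreSum

/-- PROVED: first component of `Ψ′`. [folklore] -/
theorem PsiV_fst (h1 : q % 3 = 1) (φ : X q → ℤ) : ((PsiV h1 φ).1 : X q → ℤ) = (3 : ℤ) • φ - pull (fibreSum φ) := rfl

/-- PROVED: second component of `Ψ′`. [folklore] -/
theorem PsiV_snd (h1 : q % 3 = 1) (φ : X q → ℤ) : (PsiV h1 φ).2 = fibreSum φ := rfl

/-- PROVED: `Φ′ Ψ′ = 3`. [folklore] -/
theorem PhiV_comp_PsiV (h1 : q % 3 = 1) : PhiV ∘ₗ PsiV h1 = (3 : ℤ) • (LinearMap.id : (X q → ℤ) →ₗ[ℤ] (X q → ℤ)) := by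
  refine LinearMap.ext fun φ => ?_
  rw [LinearMap.comp_apply, show PsiV h1 φ = ((PsiV h1 φ).1, (PsiV h1 φ).2) from rfl, PhiV_apply, PsiV_fst, PsiV_snd,
    sub_add_cancel, LinearMap.smul_apply, LinearMap.id_apply]

/-- PROVED: `Ψ′ Φ′ = 3`. [folklore] -/
theorem PsiV_comp_PhiV (h1 : q % 3 = 1) :
    PsiV h1 ∘ₗ PhiV = (3 : ℤ) • (LinearMap.id : (V1 q × (Steinberg.P1 q → ℤ)) →ₗ[ℤ] (V1 q × (Steinberg.P1 q → ℤ))) := by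
  refine LinearMap.ext fun vψ => ?_
  obtain ⟨v, ψ⟩ := vψ
  have hv : fibreSum (v : X q → ℤ) = 0 := v.2
  have hψ : fibreSum (pull ψ) = (3 : ℤ) • ψ := by
    rw [← LinearMap.comp_apply, fibreSum_comp_pull h1, LinearMap.smul_apply, LinearMap.id_apply]
  have hsum : fibreSum ((v : X q → ℤ) + pull ψ) = (3 : ℤ) • ψ := by rw [map_add, hv, hψ, zero_add]
  rw [LinearMap.comp_apply, PhiV_apply, LinearMap.smul_apply, LinearMap.id_apply]
  apply Prod.ext
  · apply Subtype.ext
    rw [PsiV_fst, hsum, map_smul, Prod.smul_fst, Submodule.coe_smul, smul_add, add_sub_cancel_right]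
  · rw [PsiV_snd, hsum, Prod.smul_snd]

/-- PROVED: `Φ′` intertwines the actions. [folklore] -/
theorem act_comp_PhiV (g : G q) : act ℤ g ∘ₗ PhiV = PhiV ∘ₗ ((actV1 g).prodMap (actP g) : _ →ₗ[ℤ] (V1 q × (Steinberg.P1 q → ℤ))) := by
  refine LinearMap.ext fun vψ => ?_
  obtain ⟨v, ψ⟩ := vψ
  rw [LinearMap.comp_apply, LinearMap.comp_apply, LinearMap.prodMap_apply, PhiV_apply, PhiV_apply, map_add]
  congr 1
  rw [← LinearMap.comp_apply, ← pull_comp_actP, LinearMap.comp_apply]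

/-- PROVED — **`tr(g | ℤ[X]) = tr(g | V₁) + tr(g | ℤ[ℙ¹])`** (`q ≡ 1 (3)`). [folklore] -/
theorem trace_act_eq_add (h1 : q % 3 = 1) (g : G q) :
    LinearMap.trace ℤ (X q → ℤ) (act ℤ g) = LinearMap.trace ℤ (V1 q) (actV1 g) + LinearMap.trace ℤ (Steinberg.P1 q → ℤ) (actP g) := by
  rw [← LinearMap.trace_prodMap']
  exact trace_eq_of_intertwine PhiV (PsiV h1) 3 (by norm_num) (PhiV_comp_PsiV h1) (PsiV_comp_PhiV h1) _ _ (act_comp_PhiV g)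

/-! ## §4 The two permutation traces and `tr(g | V₁) = 2·χ_W(g)` -/

/-- PROVED: `tr(g | ℤ[X]) = #Fix(g | X)`. [folklore] -/
theorem trace_act_eq_card (g : G q) :
    LinearMap.trace ℤ (X q → ℤ) (act ℤ g) = ((Finset.univ.filter fun x : X q => σX g x = x).card : ℤ) := by
  rw [act, trace_funLeft_perm_int, map_inv, card_fixed_inv]

/-- PROVED: `tr(g | ℤ[ℙ¹]) = #Fix(g | ℙ¹)`. [folklore] -/
theorem trace_actP_eq_card (g : G q) :
    LinearMap.trace ℤ (Steinberg.P1 q → ℤ) (actP g) = ((Finset.univ.filter fun p : Steinberg.P1 q => g • p = p).card : ℤ) := by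
  rw [actP, trace_funLeft_perm_int]
  congr 2
  ext p
  simp only [Finset.mem_filter, Finset.mem_univ, true_and, MulAction.toPerm_apply, inv_smul_eq_iff]
  exact eq_comm

/-- PROVED (`q ≡ 1 (3)`): `#Fix(g | X) = F(g)`, the type expression of `…CubicPointsFixedCount`. [folklore] -/
theorem card_fixed_X (h1 : q % 3 = 1) (g : G q) :
    (Finset.univ.filter fun x : X q => σX g x = x).card =
      (if IsScalarMat (g : Mat q) then 3 * (q + 1)
        else if (g : Mat q).trace ^ 2 - 4 * (g : Mat q).det = 0 then 3
        else if HasRatEigenvalue (g : Mat q) then (if IsScalarMat ((g : Mat q) ^ ((q - 1) / 3)) then 6 else 0) else 0) := by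
  have hK : 0 < Nat.card (cubes q) := Nat.card_pos
  apply Nat.eq_of_mul_eq_mul_left hK
  rw [card_fixed_mul_card_cubes g, CubicPointsFixed.card_eigvecCube_eq_fixedType h1 g, card_cubes h1]

/-- PROVED (`q ≡ 1 (3)`): `#Fix(g | ℙ¹) = F_{ℙ¹}(g)`. [folklore] -/
theorem card_fixed_P1 (h1 : q % 3 = 1) (g : G q) :
    (Finset.univ.filter fun p : Steinberg.P1 q => g • p = p).card =
      (if IsScalarMat (g : Mat q) then q + 1
        else if (g : Mat q).trace ^ 2 - 4 * (g : Mat q).det = 0 then 1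
        else if HasRatEigenvalue (g : Mat q) then 2 else 0) := by
  have hq2 : q ≠ 2 := by rintro rfl; simp at h1
  rw [← FixedPoints.natCard_fixed_P1 hq2 g, Nat.card_eq_fintype_card, Fintype.card_subtype]

/-- PROVED — **`tr(g | V₁) = 2·χ_W(g)`** for every `g ∈ GL₂(𝔽_q)`, `q ≡ 1 (mod 3)`, `χ_W = cubicNewvectorChar q` BY NAME. [folklore] -/
theorem trace_actV1 (h1 : q % 3 = 1) (g : G q) : LinearMap.trace ℤ (V1 q) (actV1 g) = 2 * cubicNewvectorChar q g := by
  have h := trace_act_eq_add h1 g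
  rw [trace_act_eq_card, trace_actP_eq_card, card_fixed_X h1, card_fixed_P1 h1] at h
  have hdiff := CubicPointsFixed.fixedType_sub_fixedP1Type h1 (g : Mat q)
  rw [cubicNewvectorChar]
  linear_combination -h + hdiff

end Summit.BirchSwinnertonDyer.BirchSwinnertonDyer.Theorems.CartanSupply.CubicV1
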